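import Summits.QuantumFields.YangMills.Theorems.EquipartitionCriticalityEquipartitionPinsProbeLiouville
import Literature.MathematicalPhysics.QuantumFieldTheory.CurvatureGaussianField
import Mathlib.Analysis.Normed.Lp.lpSpace
import Mathlib.Analysis.LocallyConvex.Separation
import HarnessLib

/-!
# Stub `stub_density` of line `Sketch` (crux `stmt-QuantumFields-8760`)

Route `EquipartitionCriticality` of `YangMills`, crux item `stmt-QuantumFields-8760`
(`Summit.QuantumFields.YangMills.Theses.EquipartitionCriticality.EquipartitionPinsProbe`), line
`Sketch`, STUB R3: on the plaquettes of `ℤ⁴`, every finitely supported real `2`-cochain `g` with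
vanishing plane sums lies in the `ℓ¹`-closure of the span `W` of the exact generators
`dδₑ = plaquetteCurl (indicator of the edge e)` and the co-exact generators (signed face cochains
of the unit `3`-cells `(x; i < j < k)`); the approximant is delivered as the data `S', E, α, K, r`.

Proof (duality in `lp (fun _ : ZdPlaquette 4 => ℝ) 1`, basis vectors `lp.single 1 p 1`). If the
image `ĝ` of `g` were not in the closure of `W`, `geometric_hahn_banach_point_closed` would give a
continuous functional `f` vanishing on `W` with `f ĝ ≠ 0`; its values `c p := f (lp.single 1 p 1)`
form a bounded `2`-cochain, `f (dδₑ) = 0` is (pointwise adjointness `Density.curl_indicator_apply`)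
the co-closedness of `c` and `f (face) = 0` its closedness, so the Hodge identity `dd* + d*d = -Δ`
(`Density.laplacian_eq_zero` = the landed STUB H `stub_hodge`, re-derived here so that this file
does not depend on the build order of today's modules) makes every plane component `c (·; i, j)`
harmonic and the landed Liouville theorem `stub_liouville` (STUB L) makes it constant, whence
`f ĝ = ∑_{i<j} c (0; i, j) · (plane sum of g) = 0`, a contradiction. An element of `W` within `ε`
of `ĝ` is unpacked (`Finsupp.mem_span_range_iff_exists_finsupp`) into `α, K, r`, its finite
support gives `S'`, and `lp.norm_eq_tsum_rpow` turns the `ℓ¹`-distance into the finite sum.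
-/

noncomputable section

open Literature.MathematicalPhysics.QuantumLattice Literature.Probability.LatticeModels
  Literature.MathematicalPhysics.QuantumFieldTheory

namespace Summit.QuantumFields.YangMills.Theorems.EquipartitionPinsProbe

namespace Density

-- adapted from `Hodge.laplacian_eq_zero` of the landed STUB H (p110812, …PinsProbeHodge.lean)
/-- **Hodge identity on `2`-cochains of `ℤ^d`, vanishing form** (`(dd* + d*d) C = -Δ C`
componentwise): if the family `C y a b` is co-closed, `∑ₖ (C y l k − C (y − eₖ) l k) = 0`, and its
cube coboundary in the directions `(i, j, k)` vanishes for every `y` and `k`, then `y ↦ C y i j` is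
harmonic (sum the coboundaries at `x` and `x − eₖ` over `k`; the mixed second differences are four
codifferential terms and what is left is `Δ C_{ij}(x)`). -/
theorem laplacian_eq_zero {d : ℕ} (C : Site d → Fin d → Fin d → ℝ) (i j : Fin d)
    (hcod : ∀ (y : Site d) (l : Fin d), ∑ k, (C y l k - C (y - Pi.single k 1) l k) = 0)
    (hcl : ∀ (y : Site d) (k : Fin d),
      (C (y + Pi.single i 1) j k - C y j k) - (C (y + Pi.single j 1) i k - C y i k) +
        (C (y + Pi.single k 1) i j - C y i j) = 0)
    (x : Site d) : latticeLaplacianZd (fun y => C y i j) x = 0 := by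
  have hA := hcod (x + Pi.single i 1) j
  have hB := hcod x j
  have hC := hcod (x + Pi.single j 1) i
  have hD := hcod x i
  have hE : ∑ k, ((C (x + Pi.single i 1) j k - C x j k) - (C (x + Pi.single j 1) i k - C x i k) +
      (C (x + Pi.single k 1) i j - C x i j)) = 0 := Finset.sum_eq_zero fun k _ => hcl x k
  have hF : ∑ k, ((C (x + Pi.single i 1 - Pi.single k 1) j k - C (x - Pi.single k 1) j k) -
      (C (x + Pi.single j 1 - Pi.single k 1) i k - C (x - Pi.single k 1) i k) +
      (C x i j - C (x - Pi.single k 1) i j)) = 0 := by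
    refine Finset.sum_eq_zero fun k _ => ?_
    have h := hcl (x - Pi.single k 1) k
    rw [sub_add_cancel] at h
    simpa only [sub_add_eq_add_sub] using h
  simp only [Finset.sum_add_distrib, Finset.sum_sub_distrib, Finset.sum_const, Finset.card_univ,
    Fintype.card_fin, nsmul_eq_mul] at hA hB hC hD hE hF
  simp only [latticeLaplacianZd_def, Finset.sum_add_distrib]
  linear_combination hE - hF - hA + hB + hC - hD

/-- **Curl of an edge indicator** (adjointness `⟨dδₑ, c⟩ = (d*c)(e)` pointwise): for the edge
`e = (x, i)` and any plaquette `q`, `dδₑ (q)` is the signed incidence number of `e` in `∂q`, written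
as the sum over the second direction `j` used by the co-differential. -/
theorem curl_indicator_apply (x : Site 4) (i : Fin 4) (q : ZdPlaquette 4) :
    plaquetteCurl (fun e : ZdEdge 4 => if e = (x, i) then (1 : ℝ) else 0) q =
      ∑ j : Fin 4,
        (if hij : i < j then
          ((if q = (x, ⟨(i, j), hij⟩) then (1 : ℝ) else 0) -
            (if q = (x - Pi.single j 1, ⟨(i, j), hij⟩) then (1 : ℝ) else 0))
        else if hji : j < i then
          ((if q = (x - Pi.single j 1, ⟨(j, i), hji⟩) then (1 : ℝ) else 0) -
            (if q = (x, ⟨(j, i), hji⟩) then (1 : ℝ) else 0))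
        else 0) := by
  obtain ⟨y, ⟨a, b⟩, hab⟩ := q
  rw [plaquetteCurl_eq]
  simp only [Fin.sum_univ_four, Prod.mk.injEq, Subtype.mk.injEq, eq_sub_iff_add_eq]
  revert hab
  fin_cases i <;> fin_cases a <;> fin_cases b <;> intro hab <;> simp +decide at hab ⊢

/-- **Linearity of the curl over a finite support**: if `α` vanishes off the finite edge set `E`,
then `dα (q) = ∑_{e ∈ E} α e · dδₑ (q)`. -/
theorem curl_eq_sum_indicator (α : ZdEdge 4 → ℝ) (E : Finset (ZdEdge 4))
    (hα : ∀ e, e ∉ E → α e = 0) (q : ZdPlaquette 4) :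
    plaquetteCurl α q =
      ∑ e ∈ E, α e * plaquetteCurl (fun e' : ZdEdge 4 => if e' = e then (1 : ℝ) else 0) q := by
  simp only [plaquetteCurl, Finset.mul_sum]
  rw [Finset.sum_comm]
  refine Finset.sum_congr rfl fun t _ => ?_
  have h : ∀ e ∈ E, α e * (plaquetteBoundarySign t * if plaquetteBoundary q t = e then 1 else 0)
      = if plaquetteBoundary q t = e then plaquetteBoundarySign t * α e else 0 :=
    fun e _ => by split_ifs <;> ring
  rw [Finset.sum_congr rfl h, Finset.sum_ite_eq]
  split_ifs with hmem
  · rfl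
  · rw [hα _ hmem, mul_zero]

end Density

/-- STUB R3 — **density of exact plus co-exact cochains among the finitely supported
`2`-cochains of `ℤ⁴` with vanishing plane sums, in `ℓ¹`**: for every such `g` and `ε > 0` there
are a finitely supported `1`-cochain `α` (support `E`), finitely many `3`-cells `K` with
coefficients `r`, and a finite plaquette set `S' ⊇ S` carrying `dα` and all faces of `K`, with
`∑_{p ∈ S'} |g p − dα p − ∑_{κ ∈ K} r κ face κ p| < ε` (Hahn–Banach in `ℓ¹`, Hodge, Liouville). -/
theorem stub_density :
    ∀ (g : Literature.MathematicalPhysics.QuantumLattice.ZdPlaquette 4 → ℝ)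
        (S : Finset (Literature.MathematicalPhysics.QuantumLattice.ZdPlaquette 4)),
      (∀ p, p ∉ S → g p = 0) →
      (∀ (i j : Fin 4) (hij : i < j),
        ∑ p ∈ S, (if p.2 = ⟨(i, j), hij⟩ then g p else 0) = 0) →
      ∀ ε : ℝ, 0 < ε →
        ∃ (S' : Finset (Literature.MathematicalPhysics.QuantumLattice.ZdPlaquette 4))
          (E : Finset (Literature.MathematicalPhysics.QuantumLattice.ZdEdge 4))
          (α : Literature.MathematicalPhysics.QuantumLattice.ZdEdge 4 → ℝ)
          (K : Finset (Literature.Probability.LatticeModels.Site 4 × Fin 4 × Fin 4 × Fin 4))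
          (r : Literature.Probability.LatticeModels.Site 4 × Fin 4 × Fin 4 × Fin 4 → ℝ),
          S ⊆ S' ∧ (∀ e, e ∉ E → α e = 0) ∧
          (∀ p, p ∉ S' → Literature.MathematicalPhysics.QuantumFieldTheory.plaquetteCurl α p = 0) ∧
          (∀ κ ∈ K, κ.2.1 < κ.2.2.1 ∧ κ.2.2.1 < κ.2.2.2 ∧
            ∀ p : Literature.MathematicalPhysics.QuantumLattice.ZdPlaquette 4,
              (fun (κ : Literature.Probability.LatticeModels.Site 4 × Fin 4 × Fin 4 × Fin 4)
                  (p : Literature.MathematicalPhysics.QuantumLattice.ZdPlaquette 4) =>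
                if hκ : κ.2.1 < κ.2.2.1 ∧ κ.2.2.1 < κ.2.2.2 then
                  ((if p = (κ.1 + Pi.single κ.2.1 1, ⟨(κ.2.2.1, κ.2.2.2), hκ.2⟩) then (1 : ℝ) else 0) -
                    (if p = (κ.1, ⟨(κ.2.2.1, κ.2.2.2), hκ.2⟩) then (1 : ℝ) else 0) -
                    (if p = (κ.1 + Pi.single κ.2.2.1 1, ⟨(κ.2.1, κ.2.2.2), hκ.1.trans hκ.2⟩) then (1 : ℝ) else 0) +
                    (if p = (κ.1, ⟨(κ.2.1, κ.2.2.2), hκ.1.trans hκ.2⟩) then (1 : ℝ) else 0) +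
                    (if p = (κ.1 + Pi.single κ.2.2.2 1, ⟨(κ.2.1, κ.2.2.1), hκ.1⟩) then (1 : ℝ) else 0) -
                    (if p = (κ.1, ⟨(κ.2.1, κ.2.2.1), hκ.1⟩) then (1 : ℝ) else 0))
                else 0) κ p ≠ 0 → p ∈ S') ∧
          ∑ p ∈ S', |g p - Literature.MathematicalPhysics.QuantumFieldTheory.plaquetteCurl α p -
              ∑ κ ∈ K, r κ *
                (fun (κ : Literature.Probability.LatticeModels.Site 4 × Fin 4 × Fin 4 × Fin 4)
                    (p : Literature.MathematicalPhysics.QuantumLattice.ZdPlaquette 4) =>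
                  if hκ : κ.2.1 < κ.2.2.1 ∧ κ.2.2.1 < κ.2.2.2 then
                    ((if p = (κ.1 + Pi.single κ.2.1 1, ⟨(κ.2.2.1, κ.2.2.2), hκ.2⟩) then (1 : ℝ) else 0) -
                      (if p = (κ.1, ⟨(κ.2.2.1, κ.2.2.2), hκ.2⟩) then (1 : ℝ) else 0) -
                      (if p = (κ.1 + Pi.single κ.2.2.1 1, ⟨(κ.2.1, κ.2.2.2), hκ.1.trans hκ.2⟩) then (1 : ℝ) else 0) +
                      (if p = (κ.1, ⟨(κ.2.1, κ.2.2.2), hκ.1.trans hκ.2⟩) then (1 : ℝ) else 0) +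
                      (if p = (κ.1 + Pi.single κ.2.2.2 1, ⟨(κ.2.1, κ.2.2.1), hκ.1⟩) then (1 : ℝ) else 0) -
                      (if p = (κ.1, ⟨(κ.2.1, κ.2.2.1), hκ.1⟩) then (1 : ℝ) else 0))
                  else 0) κ p| < ε := by
  intro g S hg hS ε hε
  suffices key : ∀ fc : Site 4 × Fin 4 × Fin 4 × Fin 4 → ZdPlaquette 4 → ℝ, (∀ κ p, fc κ p =
      if hκ : κ.2.1 < κ.2.2.1 ∧ κ.2.2.1 < κ.2.2.2 then
        ((if p = (κ.1 + Pi.single κ.2.1 1, ⟨(κ.2.2.1, κ.2.2.2), hκ.2⟩) then (1 : ℝ) else 0) -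
          (if p = (κ.1, ⟨(κ.2.2.1, κ.2.2.2), hκ.2⟩) then (1 : ℝ) else 0) -
          (if p = (κ.1 + Pi.single κ.2.2.1 1, ⟨(κ.2.1, κ.2.2.2), hκ.1.trans hκ.2⟩) then (1 : ℝ)
            else 0) +
          (if p = (κ.1, ⟨(κ.2.1, κ.2.2.2), hκ.1.trans hκ.2⟩) then (1 : ℝ) else 0) +
          (if p = (κ.1 + Pi.single κ.2.2.2 1, ⟨(κ.2.1, κ.2.2.1), hκ.1⟩) then (1 : ℝ) else 0) -
          (if p = (κ.1, ⟨(κ.2.1, κ.2.2.1), hκ.1⟩) then (1 : ℝ) else 0))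
      else 0) →
      ∃ (S' : Finset (ZdPlaquette 4)) (E : Finset (ZdEdge 4)) (α : ZdEdge 4 → ℝ)
        (K : Finset (Site 4 × Fin 4 × Fin 4 × Fin 4)) (r : Site 4 × Fin 4 × Fin 4 × Fin 4 → ℝ),
        S ⊆ S' ∧ (∀ e, e ∉ E → α e = 0) ∧ (∀ p, p ∉ S' → plaquetteCurl α p = 0) ∧
        (∀ κ ∈ K, κ.2.1 < κ.2.2.1 ∧ κ.2.2.1 < κ.2.2.2 ∧ ∀ p, fc κ p ≠ 0 → p ∈ S') ∧
        ∑ p ∈ S', |g p - plaquetteCurl α p - ∑ κ ∈ K, r κ * fc κ p| < ε from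
    key _ fun _ _ => rfl
  intro fc hfc
  obtain ⟨sgl, hsgl⟩ : ∃ sgl : ZdPlaquette 4 → lp (fun _ : ZdPlaquette 4 => ℝ) 1,
      ∀ p, sgl p = lp.single 1 p (1 : ℝ) := ⟨_, fun _ => rfl⟩
  have sgl_apply : ∀ p q, (sgl p : ZdPlaquette 4 → ℝ) q = if q = p then 1 else 0 :=
    fun p q => by rw [hsgl, lp.single_apply, Pi.single_apply]
  have norm_sgl : ∀ p, ‖sgl p‖ = 1 := fun p => by rw [hsgl, lp.norm_single one_pos, norm_one]
  have sgl_fin : ∀ p, Memℓp (sgl p : ZdPlaquette 4 → ℝ) 0 := fun p => by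
    rw [hsgl, lp.coeFn_single]
    exact lp.memℓp (lp.single 0 p 1)
  -- the generators: exact `X (x, i) ≃ dδ_{(x,i)}` and co-exact `F κ ≃` face cochain of `κ`
  obtain ⟨X, hX⟩ : ∃ X : ZdEdge 4 → lp (fun _ : ZdPlaquette 4 => ℝ) 1,
      ∀ (x : Site 4) (i : Fin 4), X (x, i) = ∑ j : Fin 4,
        (if hij : i < j then sgl (x, ⟨(i, j), hij⟩) - sgl (x - Pi.single j 1, ⟨(i, j), hij⟩)
        else if hji : j < i then sgl (x - Pi.single j 1, ⟨(j, i), hji⟩) - sgl (x, ⟨(j, i), hji⟩)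
        else 0) := by
    refine ⟨fun e => ∑ j : Fin 4, (if hij : e.2 < j then
        sgl (e.1, ⟨(e.2, j), hij⟩) - sgl (e.1 - Pi.single j 1, ⟨(e.2, j), hij⟩)
      else if hji : j < e.2 then sgl (e.1 - Pi.single j 1, ⟨(j, e.2), hji⟩) - sgl (e.1, ⟨(j, e.2), hji⟩)
      else 0), ?_⟩
    intro x i
    rfl
  obtain ⟨F, hF⟩ : ∃ F : Site 4 × Fin 4 × Fin 4 × Fin 4 → lp (fun _ : ZdPlaquette 4 => ℝ) 1,
      ∀ κ, F κ = if hκ : κ.2.1 < κ.2.2.1 ∧ κ.2.2.1 < κ.2.2.2 then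
        sgl (κ.1 + Pi.single κ.2.1 1, ⟨(κ.2.2.1, κ.2.2.2), hκ.2⟩) -
          sgl (κ.1, ⟨(κ.2.2.1, κ.2.2.2), hκ.2⟩) -
          sgl (κ.1 + Pi.single κ.2.2.1 1, ⟨(κ.2.1, κ.2.2.2), hκ.1.trans hκ.2⟩) +
          sgl (κ.1, ⟨(κ.2.1, κ.2.2.2), hκ.1.trans hκ.2⟩) +
          sgl (κ.1 + Pi.single κ.2.2.2 1, ⟨(κ.2.1, κ.2.2.1), hκ.1⟩) -
          sgl (κ.1, ⟨(κ.2.1, κ.2.2.1), hκ.1⟩)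
      else 0 := ⟨_, fun _ => rfl⟩
  have X_apply : ∀ (e : ZdEdge 4) (q : ZdPlaquette 4), (X e : ZdPlaquette 4 → ℝ) q =
      plaquetteCurl (fun e' : ZdEdge 4 => if e' = e then (1 : ℝ) else 0) q := by
    rintro ⟨x, i⟩ q
    rw [hX, Density.curl_indicator_apply, lp.coeFn_sum, Finset.sum_apply]
    refine Finset.sum_congr rfl fun j _ => ?_
    rcases lt_trichotomy i j with hij | rfl | hji
    · simp only [dif_pos hij, lp.coeFn_sub, Pi.sub_apply, sgl_apply]
    · simp only [dif_neg (lt_irrefl _), lp.coeFn_zero, Pi.zero_apply]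
    · simp only [dif_neg (lt_asymm hji), dif_pos hji, lp.coeFn_sub, Pi.sub_apply, sgl_apply]
  have F_apply : ∀ κ (q : ZdPlaquette 4), (F κ : ZdPlaquette 4 → ℝ) q = fc κ q := fun κ q => by
    rw [hF, hfc]
    by_cases hκ : κ.2.1 < κ.2.2.1 ∧ κ.2.2.1 < κ.2.2.2
    · simp only [dif_pos hκ, lp.coeFn_sub, lp.coeFn_add, Pi.sub_apply, Pi.add_apply, sgl_apply]
    · simp only [dif_neg hκ, lp.coeFn_zero, Pi.zero_apply]
  -- finitely supported elements form a submodule `S₀` containing the generators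
  obtain ⟨S₀, hS₀⟩ : ∃ S₀ : Submodule ℝ (lp (fun _ : ZdPlaquette 4 => ℝ) 1),
      ∀ u, u ∈ S₀ ↔ Memℓp (u : ZdPlaquette 4 → ℝ) 0 :=
    ⟨{ carrier := {u | Memℓp (u : ZdPlaquette 4 → ℝ) 0}
       add_mem' := fun ha hb => ha.add hb
       zero_mem' := zero_memℓp
       smul_mem' := fun t u hu => Memℓp.const_smul hu t }, fun _ => Iff.rfl⟩
  have sgl_mem : ∀ p, sgl p ∈ S₀ := fun p => (hS₀ _).2 (sgl_fin p)
  have X_mem : ∀ e, X e ∈ S₀ := by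
    rintro ⟨x, i⟩
    rw [hX]
    refine Submodule.sum_mem _ fun j _ => ?_
    split_ifs
    exacts [sub_mem (sgl_mem _) (sgl_mem _), sub_mem (sgl_mem _) (sgl_mem _), zero_mem _]
  have F_mem : ∀ κ, F κ ∈ S₀ := fun κ => by
    rw [hF]
    split_ifs
    · apply_rules [sub_mem, add_mem, sgl_mem]
    · exact zero_mem _
  -- the span `W` of the generators and the embedded cochain `gh ≃ g`
  obtain ⟨W, hW⟩ : ∃ W : Submodule ℝ (lp (fun _ : ZdPlaquette 4 => ℝ) 1),
      W = Submodule.span ℝ (Set.range X ∪ Set.range F) := ⟨_, rfl⟩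
  have hWS₀ : W ≤ S₀ := by
    rw [hW, Submodule.span_le]
    rintro _ (⟨e, rfl⟩ | ⟨κ, rfl⟩)
    exacts [X_mem e, F_mem κ]
  obtain ⟨gh, hgh⟩ : ∃ gh : lp (fun _ : ZdPlaquette 4 => ℝ) 1, gh = ∑ p ∈ S, g p • sgl p :=
    ⟨_, rfl⟩
  have gh_apply : ∀ q, (gh : ZdPlaquette 4 → ℝ) q = g q := fun q => by
    rw [hgh, lp.coeFn_sum, Finset.sum_apply]
    simp only [lp.coeFn_smul, Pi.smul_apply, sgl_apply, smul_eq_mul, mul_ite, mul_one, mul_zero]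
    rw [Finset.sum_ite_eq]
    split_ifs with hq
    exacts [rfl, (hg q hq).symm]
  -- duality: `gh` lies in the closure of `W`
  have hmem : gh ∈ W.topologicalClosure := by
    by_contra hnot
    obtain ⟨f, u, hfu, hub⟩ := geometric_hahn_banach_point_closed W.topologicalClosure.convex
      W.isClosed_topologicalClosure hnot
    have hu : u < 0 := by simpa using hub 0 (zero_mem _)
    have hfW : ∀ w ∈ W, f w = 0 := by
      intro w hw
      by_contra hne
      have h := hub ((u / f w) • w) (Submodule.smul_mem _ _ (W.le_topologicalClosure hw))
      rw [map_smul, smul_eq_mul, div_mul_cancel₀ u hne] at h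
      exact lt_irrefl _ h
    -- the bounded `2`-cochain `c` represented by `f` and its antisymmetric extension `C`
    obtain ⟨c, hc⟩ : ∃ c : ZdPlaquette 4 → ℝ, ∀ p, c p = f (sgl p) := ⟨_, fun _ => rfl⟩
    obtain ⟨C, hC⟩ : ∃ C : Site 4 → Fin 4 → Fin 4 → ℝ, ∀ y a b, C y a b =
        if h : a < b then c (y, ⟨(a, b), h⟩) else if h' : b < a then -c (y, ⟨(b, a), h'⟩) else 0 :=
      ⟨_, fun _ _ _ => rfl⟩
    have hfX : ∀ e, f (X e) = 0 := fun e =>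
      hfW _ (hW ▸ Submodule.subset_span (Or.inl ⟨e, rfl⟩))
    have hfF : ∀ κ, f (F κ) = 0 := fun κ =>
      hfW _ (hW ▸ Submodule.subset_span (Or.inr ⟨κ, rfl⟩))
    have hbdd : ∀ p, |c p| ≤ ‖f‖ := fun p => by
      have h := f.le_opNorm (sgl p)
      rwa [norm_sgl, mul_one, Real.norm_eq_abs, ← hc] at h
    -- `C` is co-closed (`f` kills every `dδₑ`)
    have hcod : ∀ (y : Site 4) (l : Fin 4), ∑ k, (C y l k - C (y - Pi.single k 1) l k) = 0 := by
      intro y l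
      have h := hfX (y, l)
      rw [hX, map_sum] at h
      refine Eq.trans (Finset.sum_congr rfl fun k _ => ?_) h
      rw [hC, hC]
      split_ifs
      · simp only [hc, map_sub]
      · simp only [hc, map_sub]; ring
      · simp only [sub_self, map_zero]
    -- each plane component of `c` is harmonic (`f` kills every face), bounded, so constant (L)
    have hconst : ∀ (i j : Fin 4) (hij : i < j) (y : Site 4),
        c (y, ⟨(i, j), hij⟩) = c (0, ⟨(i, j), hij⟩) := by
      intro i j hij
      have hharm : ∀ x, latticeLaplacianZd (fun y => c (y, ⟨(i, j), hij⟩)) x = 0 := by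
        intro x
        have key := Density.laplacian_eq_zero C i j hcod (fun y k => ?_) x
        · simpa only [hC, dif_pos hij] using key
        rcases lt_trichotomy j k with hjk | rfl | hkj
        · have h := hfF (y, i, j, k)
          rw [hF, dif_pos ⟨hij, hjk⟩] at h
          simp only [map_add, map_sub, hC, dif_pos hjk, dif_pos (hij.trans hjk), dif_pos hij,
            hc] at h ⊢
          linear_combination h
        · simp only [hC, dif_neg (lt_irrefl j), dif_pos hij]; ring
        · rcases lt_trichotomy i k with hik | rfl | hki
          · have h := hfF (y, i, k, j)
            rw [hF, dif_pos ⟨hik, hkj⟩] at h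
            simp only [map_add, map_sub, hC, dif_neg (lt_asymm hkj), dif_pos hkj, dif_pos hik,
              dif_pos hij, hc] at h ⊢
            linear_combination (-1 : ℝ) * h
          · simp only [hC, dif_neg (lt_asymm hij), dif_neg (lt_irrefl i), dif_pos hij]; ring
          · have h := hfF (y, k, i, j)
            rw [hF, dif_pos ⟨hki, hij⟩] at h
            simp only [map_add, map_sub, hC, dif_neg (lt_asymm hkj), dif_pos hkj,
              dif_neg (lt_asymm hki), dif_pos hki, dif_pos hij, hc] at h ⊢
            linear_combination h
      exact fun y => stub_liouville 4 _ ⟨‖f‖, fun y => hbdd _⟩ hharm y 0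
    -- so `f gh = ∑ g c = ∑_{planes} c(0; plane) · (plane sum of g) = 0`: contradiction
    have hfgh : f gh = ∑ p ∈ S, g p * c p := by
      rw [hgh, map_sum]
      exact Finset.sum_congr rfl fun p _ => by rw [map_smul, smul_eq_mul, hc]
    have hsum : ∑ p ∈ S, g p * c p = 0 := by
      calc ∑ p ∈ S, g p * c p
          = ∑ p ∈ S, ∑ π : {ij : Fin 4 × Fin 4 // ij.1 < ij.2},
              (if p.2 = π then g p * c (0, π) else 0) := by
            refine Finset.sum_congr rfl fun p _ => ?_
            rw [Finset.sum_ite_eq, if_pos (Finset.mem_univ _)]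
            obtain ⟨y, ⟨i, j⟩, hij⟩ := p
            exact congrArg _ (hconst i j hij y)
        _ = ∑ π : {ij : Fin 4 × Fin 4 // ij.1 < ij.2},
              c (0, π) * ∑ p ∈ S, (if p.2 = π then g p else 0) := by
            rw [Finset.sum_comm]
            refine Finset.sum_congr rfl fun π _ => ?_
            rw [Finset.mul_sum]
            exact Finset.sum_congr rfl fun p _ => by split_ifs <;> ring
        _ = 0 := Finset.sum_eq_zero fun π _ => by
            obtain ⟨⟨i, j⟩, hij⟩ := π
            rw [hS i j hij, mul_zero]
    exact (hfu.trans hu).ne (hfgh.trans hsum)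
  -- approximation: pick `w ∈ W` within `ε` of `gh` and unpack it
  have hcl_mem : gh ∈ closure (W : Set (lp (fun _ : ZdPlaquette 4 => ℝ) 1)) := by
    rwa [← Submodule.topologicalClosure_coe]
  obtain ⟨w, hwW, hdist⟩ := Metric.mem_closure_iff.1 hcl_mem ε hε
  have hwW' : w ∈ Submodule.span ℝ (Set.range X) ⊔ Submodule.span ℝ (Set.range F) := by
    rwa [← Submodule.span_union, ← hW]
  obtain ⟨y, hy, z, hz, rfl⟩ := Submodule.mem_sup.1 hwW'
  obtain ⟨a, rfl⟩ := Finsupp.mem_span_range_iff_exists_finsupp.1 hy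
  obtain ⟨b, rfl⟩ := Finsupp.mem_span_range_iff_exists_finsupp.1 hz
  set K : Finset (Site 4 × Fin 4 × Fin 4 × Fin 4) :=
    b.support.filter (fun κ => κ.2.1 < κ.2.2.1 ∧ κ.2.2.1 < κ.2.2.2) with hK
  have ha_apply : ∀ q, ((a.sum fun e t => t • X e : lp (fun _ : ZdPlaquette 4 => ℝ) 1) :
      ZdPlaquette 4 → ℝ) q = plaquetteCurl (⇑a) q := by
    intro q
    rw [Finsupp.sum, lp.coeFn_sum, Finset.sum_apply, Density.curl_eq_sum_indicator (⇑a) a.support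
      (fun e he => Finsupp.notMem_support_iff.1 he) q]
    refine Finset.sum_congr rfl fun e _ => ?_
    rw [lp.coeFn_smul, Pi.smul_apply, smul_eq_mul, X_apply e q]
  have hb_apply : ∀ q, ((b.sum fun κ t => t • F κ : lp (fun _ : ZdPlaquette 4 => ℝ) 1) :
      ZdPlaquette 4 → ℝ) q = ∑ κ ∈ K, b κ * fc κ q := by
    intro q
    rw [Finsupp.sum, lp.coeFn_sum, Finset.sum_apply, hK, Finset.sum_filter]
    refine Finset.sum_congr rfl fun κ _ => ?_
    rw [lp.coeFn_smul, Pi.smul_apply, smul_eq_mul, F_apply κ q]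
    split_ifs with h
    · rfl
    · rw [hfc, dif_neg h, mul_zero]
  have ha_fin : Set.Finite {q | ((a.sum fun e t => t • X e : lp (fun _ : ZdPlaquette 4 => ℝ) 1) :
      ZdPlaquette 4 → ℝ) q ≠ 0} :=
    Memℓp.finite_dsupport ((hS₀ _).1 (hWS₀ (hW ▸ Submodule.span_mono Set.subset_union_left hy)))
  have F_fin : ∀ κ, Set.Finite {q | (F κ : ZdPlaquette 4 → ℝ) q ≠ 0} := fun κ =>
    Memℓp.finite_dsupport ((hS₀ _).1 (F_mem κ))
  set S' : Finset (ZdPlaquette 4) :=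
    S ∪ ha_fin.toFinset ∪ K.biUnion (fun κ => (F_fin κ).toFinset) with hS'
  have hS_sub : S ⊆ S' := (Finset.subset_union_left).trans Finset.subset_union_left
  have hcurl_zero : ∀ q, q ∉ S' → plaquetteCurl (⇑a) q = 0 := fun q hq => by
    by_contra h
    exact hq (Finset.mem_union_left _ (Finset.mem_union_right _
      (ha_fin.mem_toFinset.2 ((ha_apply q).trans_ne h))))
  have hF_zero : ∀ κ ∈ K, ∀ q, q ∉ S' → fc κ q = 0 := fun κ hκ q hq => by
    by_contra h
    exact hq (Finset.mem_union_right _ (Finset.mem_biUnion.2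
      ⟨κ, hκ, (F_fin κ).mem_toFinset.2 ((F_apply κ q).trans_ne h)⟩))
  have hg_zero : ∀ q, q ∉ S' → g q = 0 := fun q hq => hg q fun h => hq (hS_sub h)
  refine ⟨S', a.support, ⇑a, K, ⇑b, hS_sub, fun e he => Finsupp.notMem_support_iff.1 he,
    hcurl_zero, fun κ hκ => ?_, ?_⟩
  · have hκ' := (Finset.mem_filter.1 hκ).2
    exact ⟨hκ'.1, hκ'.2, fun p hp => by_contra fun hpS => hp (hF_zero κ hκ p hpS)⟩
  · -- the `ℓ¹`-distance is the finite sum of the statement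
    have hnorm : ‖gh - ((a.sum fun e t => t • X e) + b.sum fun κ t => t • F κ)‖ =
        ∑ p ∈ S', |g p - plaquetteCurl (⇑a) p - ∑ κ ∈ K, b κ * fc κ p| := by
      rw [lp.norm_eq_tsum_rpow (by norm_num)]
      simp only [ENNReal.toReal_one, Real.rpow_one, div_one]
      rw [tsum_eq_sum (s := S')]
      · refine Finset.sum_congr rfl fun q _ => ?_
        rw [Real.norm_eq_abs, lp.coeFn_sub, lp.coeFn_add, Pi.sub_apply, Pi.add_apply, gh_apply,
          ha_apply, hb_apply, sub_sub]
      · intro q hq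
        rw [lp.coeFn_sub, lp.coeFn_add, Pi.sub_apply, Pi.add_apply, gh_apply, ha_apply, hb_apply,
          hg_zero q hq, hcurl_zero q hq, Finset.sum_eq_zero (fun κ hκ => ?_)]
        · simp
        · rw [hF_zero κ hκ q hq, mul_zero]
    rw [← hnorm, ← dist_eq_norm]
    exact hdist

end Summit.QuantumFields.YangMills.Theorems.EquipartitionPinsProbe

end
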